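import Mathlib
import Literature.Computability.AlgebraicComplexity.NestFreeMatchingPoly
import Literature.Computability.AlgebraicComplexity.ArithCircuitProofs
import Literature.Computability.AlgebraicComplexity.BurgisserBooleanPartsA3Steps
import Summits.ValiantsHypothesis.ValiantsHypothesis.Theorems.FifoMatchingNNDivisionHardHyperDegree
import Summits.ValiantsHypothesis.ValiantsHypothesis.Theses.FifoMatching
import HarnessLib

/-!
# `NNDivisionHard` (stmt-ValiantsHypothesis-21181) with the cofactor charged EXPONENTIALLY holds;
# the open residual in the cofactor-COST axis is exactly the mid-cost cofactors `⌊n^{1/8}⌋ < L₊(h) ≤ 2^{polylog n}`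

Route `ValiantsHypothesis/FifoMatching`, helper toward crux stmt-21181 (`NNDivisionHard`: `∀ c`, eventually
`2^((log₂ n + c)^c) < L₊(NN_n · h) + L₊(h)` for every nonzero `h ∈ ℝ≥0[x]`).

The landed exponential rung R2-exp (`GridCorShadow.expRung_holds`: eventually `2^{⌊n^{1/8}⌋} < L₊(NN_n · h)` for every
`h ≠ 0` of total DEGREE `≤ 2^{⌊n^{1/8}⌋}`) is read in the cofactor-COST axis through Bürgisser's degree bound
`deg ≤ 2^{size}` for fan-in-two circuits (`totalDegree_eval_le_two_pow_size`, any commutative semiring):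

* `expRung_of_cheapCofactor` — eventually, every `h ≠ 0` with `L₊(h) ≤ ⌊n^{1/8}⌋` has `2^{⌊n^{1/8}⌋} < L₊(NN_n · h)`
  (a circuit of size `s` has degree `≤ 2^s`, so cheap cofactors are low-degree cofactors).
* ★ `nnDivisionHard_expCharged` — **the crux with the cofactor charged exponentially is a THEOREM**: eventually,
  `2^{⌊n^{1/8}⌋} < L₊(NN_n · h) + 2^{L₊(h)}` for EVERY nonzero `h` (no degree or cost hypothesis); and its by-name twin
  `nnDivisionHard_expCharged_inlined` over the route's inlined `NN_n`.  The crux 21181 is the same inequality with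
  the charge `2^{L₊(h)}` lowered to `L₊(h)` (and threshold `2^{polylog}`).
* ★ `nnDivisionHard_iff_midCostCofactor` — **21181 ⟺ its MID-COST tier**: what is open is exactly the certificates
  whose cofactor has `⌊n^{1/8}⌋ < L₊(h) ≤ 2^((log₂ n + c)^c)` (below: `expRung_of_cheapCofactor`; above: the charge
  `+ L₊(h)` alone exceeds the threshold).  Consistent with (and implied pointwise by) the landed hyper-degree tier
  `HyperDegree.nnDivisionHard_iff_hyperDegree` (`deg h > 2^{⌊n^{1/8}⌋}` forces `L₊(h) > ⌊n^{1/8}⌋`); stated here in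
  the single currency `L₊`.

HONEST FRAMING: monotone-world bookkeeping over landed rungs; stmt-21181 stays OPEN; nothing here bears on `NNNotVP` or
on VP ≠ VNP (NOT proved).

References: P. Bürgisser, *Completeness and Reduction in Algebraic Complexity Theory* (2000) / TCS 2000 Lemma 2.4
(`deg ≤ 2^{depth}`) [Burgisser2000]; P. Hrubeš, A. Yehudayoff, *Shadows of Newton polytopes*, CCC 2021, Prop 43(2) /
Rem 20, §6 Problem 2 [HrubesYehudayoff2021].
-/

set_option autoImplicit false

-- the mandated summit-side namespace repeats a component by design (single-problem summit)
set_option linter.dupNamespace false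

noncomputable section

namespace Summit.ValiantsHypothesis.ValiantsHypothesis.Theorems.FifoMatching

namespace NNDivisionHard.CofactorCost

open scoped NNReal BigOperators Classical
open MvPolynomial
open Literature.Computability.AlgebraicComplexity

/-- **Cheap cofactors are low-degree cofactors, hence covered by R2-exp**: eventually in `n`, every nonzero `h` with
`L₊(h) ≤ ⌊n^{1/8}⌋` has `2^{⌊n^{1/8}⌋} < L₊(NN_n · h)` (`deg h ≤ 2^{L₊(h)}` by `totalDegree_eval_le_two_pow_size` at a
size-optimal fan-in-two circuit, then `GridCorShadow.expRung_holds`). [cite: Burgisser2000TCS, Lemma 2.4 p. 77]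
[cite: HrubesYehudayoff2021, Prop 43(2)/Rem 20] -/
theorem expRung_of_cheapCofactor :
    ∃ n₀ : ℕ, ∀ n ≥ n₀, ∀ h : MvPolynomial (Fin (2 * n) × Fin (2 * n)) ℝ≥0, h ≠ 0 →
      complexity h ≤ Nat.sqrt (Nat.sqrt (Nat.sqrt n)) →
        2 ^ Nat.sqrt (Nat.sqrt (Nat.sqrt n)) < complexity (nestFreeMatchingPoly n ℝ≥0 * h) := by
  obtain ⟨n₀, hn₀⟩ := GridCorShadow.expRung_holds
  refine ⟨n₀, fun n hn h hh hL => hn₀ n hn h hh ?_⟩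
  obtain ⟨P, h2, hP, hsize⟩ := ArithCircuit.exists_computes_size_eq_complexity h
  calc h.totalDegree = P.eval.totalDegree := by rw [show P.eval = h from hP]
    _ ≤ 2 ^ P.size := totalDegree_eval_le_two_pow_size h2
    _ ≤ 2 ^ Nat.sqrt (Nat.sqrt (Nat.sqrt n)) := by
        rw [hsize]; exact Nat.pow_le_pow_right Nat.two_pos hL

/-- ★ **`NNDivisionHard` WITH EXPONENTIAL COFACTOR CHARGE — PROVED**: eventually in `n`, for EVERY nonzero cofactor
`h ∈ ℝ≥0[x]`, `2^{⌊n^{1/8}⌋} < L₊(NN_n · h) + 2^{L₊(h)}`.  (The crux stmt-21181 is this inequality with the charge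
`2^{L₊(h)}` replaced by `L₊(h)` and the threshold by `2^((log₂ n + c)^c)`.) [cite: HrubesYehudayoff2021, §6 Problem 2] -/
theorem nnDivisionHard_expCharged :
    ∃ n₀ : ℕ, ∀ n ≥ n₀, ∀ h : MvPolynomial (Fin (2 * n) × Fin (2 * n)) ℝ≥0, h ≠ 0 →
      2 ^ Nat.sqrt (Nat.sqrt (Nat.sqrt n)) < complexity (nestFreeMatchingPoly n ℝ≥0 * h) + 2 ^ complexity h := by
  obtain ⟨n₀, hn₀⟩ := expRung_of_cheapCofactor
  refine ⟨n₀, fun n hn h hh => ?_⟩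
  by_cases hL : complexity h ≤ Nat.sqrt (Nat.sqrt (Nat.sqrt n))
  · exact Nat.lt_add_right _ (hn₀ n hn h hh hL)
  · have hlt : 2 ^ Nat.sqrt (Nat.sqrt (Nat.sqrt n)) < 2 ^ complexity h :=
      Nat.pow_lt_pow_right (by norm_num) (lt_of_not_ge hL)
    exact lt_of_lt_of_le hlt (Nat.le_add_left _ _)

/-- The same over the route's INLINED `NN_n` (definitionally `nestFreeMatchingPoly n ℝ≥0`), for by-name comparison with
the route decl `Theses.FifoMatching.NNDivisionHard`. [cite: HrubesYehudayoff2021, §6 Problem 2] -/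
theorem nnDivisionHard_expCharged_inlined :
    ∃ n₀ : ℕ, ∀ n ≥ n₀, ∀ h : MvPolynomial (Fin (2 * n) × Fin (2 * n)) NNReal, h ≠ 0 → 2 ^ Nat.sqrt (Nat.sqrt (Nat.sqrt n)) < Literature.Computability.AlgebraicComplexity.complexity ((∑ M : Fin (2 * n) → Fin (2 * n), if ((∀ i, M (M i) = i) ∧ (∀ i, M i ≠ i) ∧ ∀ i j, i < j → j < M j → M j < M i → False) then ∏ i : Fin (2 * n), (if i < M i then MvPolynomial.X (i, M i) else 1) else (0 : MvPolynomial (Fin (2 * n) × Fin (2 * n)) NNReal)) * h) + 2 ^ Literature.Computability.AlgebraicComplexity.complexity h :=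
  nnDivisionHard_expCharged

/-- ★ **`NNDivisionHard` ⟺ its MID-COST tier**: the crux holds iff, for every `c`, eventually every nonzero cofactor
with `⌊n^{1/8}⌋ < L₊(h) ≤ 2^((log₂ n + c)^c)` satisfies `2^((log₂ n + c)^c) < L₊(NN_n · h) + L₊(h)`.  Cheap cofactors
are handled by `expRung_of_cheapCofactor` (with `HyperDegree.polylog_le_root8`), expensive ones by the charge itself.
[cite: HrubesYehudayoff2021, §6 Problem 2] -/
theorem nnDivisionHard_iff_midCostCofactor :
    Summit.ValiantsHypothesis.ValiantsHypothesis.Theses.FifoMatching.NNDivisionHard ↔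
    ∀ c : ℕ, ∃ n₀ : ℕ, ∀ n ≥ n₀, ∀ h : MvPolynomial (Fin (2 * n) × Fin (2 * n)) ℝ≥0, h ≠ 0 →
      Nat.sqrt (Nat.sqrt (Nat.sqrt n)) < complexity h → complexity h ≤ 2 ^ ((Nat.log 2 n + c) ^ c) →
        2 ^ ((Nat.log 2 n + c) ^ c) < complexity (nestFreeMatchingPoly n ℝ≥0 * h) + complexity h := by
  constructor
  · intro hD c
    obtain ⟨n₀, hn₀⟩ := hD c
    exact ⟨n₀, fun n hn h hh _ _ => hn₀ n hn h hh⟩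
  · intro hM c
    obtain ⟨n₁, hn₁⟩ := hM c
    obtain ⟨n₂, hn₂⟩ := expRung_of_cheapCofactor
    obtain ⟨n₃, hn₃⟩ := HyperDegree.polylog_le_root8 c
    refine ⟨max n₁ (max n₂ n₃), fun n hn h hh => ?_⟩
    have hn1 : n₁ ≤ n := le_trans (le_max_left _ _) hn
    have hn2 : n₂ ≤ n := le_trans ((le_max_left _ _).trans (le_max_right _ _)) hn
    have hn3 : n₃ ≤ n := le_trans ((le_max_right _ _).trans (le_max_right _ _)) hn
    show 2 ^ ((Nat.log 2 n + c) ^ c) < complexity (nestFreeMatchingPoly n ℝ≥0 * h) + complexity h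
    by_cases hlo : complexity h ≤ Nat.sqrt (Nat.sqrt (Nat.sqrt n))
    · have h1 := hn₂ n hn2 h hh hlo
      have h2 : 2 ^ ((Nat.log 2 n + c) ^ c) ≤ 2 ^ Nat.sqrt (Nat.sqrt (Nat.sqrt n)) :=
        Nat.pow_le_pow_right (by norm_num) (hn₃ n hn3)
      exact lt_of_le_of_lt h2 (lt_of_lt_of_le h1 (Nat.le_add_right _ _))
    · by_cases hhi : complexity h ≤ 2 ^ ((Nat.log 2 n + c) ^ c)
      · exact hn₁ n hn1 h hh (lt_of_not_ge hlo) hhi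
      · exact lt_of_lt_of_le (lt_of_not_ge hhi) (Nat.le_add_left _ _)

end NNDivisionHard.CofactorCost

end Summit.ValiantsHypothesis.ValiantsHypothesis.Theorems.FifoMatching

end
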